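import Summits.ResolutionOfSingularities.ResolutionOfSingularities.Theorems.FrobeniusLadderRegularStalksClimb
import Literature.RingTheory.TightClosure.RegularTightlyClosed
import Literature.RingTheory.TightClosure.TightClosure
import Mathlib.RingTheory.RegularLocalRing.Defs
import HarnessLib

/-!
# Regular local rings of prime characteristic satisfy the stalk clause of `FInjectiveMacaulayfication`

Support file for crux stmt-ResolutionOfSingularities-15315 (`FrobeniusLadder.FInjectiveMacaulayfication`,
line `Sketch`, lead seat c4, cycle 5, wave 2): stub `stub_fiClauseOfRegular` of the §7 CALIBRATION package
(`Bl_𝔪 E₈⁰` in characteristic 5, through the blow-up glue E6′). Most chart points of the calibration model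
are certified by REGULARITY (Jacobian criterion); this file is the ring-level form of the scheme-level fact
`Negative.rung_of_isRegular`: for every prime `p` and every regular local ring `O` of characteristic `p`,

* `O` is a domain (Matsumura Thm. 14.3, `isDomain_of_isRegularLocalRing`);
* every system of parameters `s : Fin d → O` (`d = dim O`, `rad (s)` maximal) is a weakly regular
  sequence (Matsumura Thm. 17.4, the first half of the route's support item `RegularStalksClimb`,
  `RegularStalksClimb_proof`);
* the parameter ideal `(s)` is Frobenius closed in the crux's inline form
  `y ^ (p ^ e) ∈ span {z ^ (p ^ e) | z ∈ (s)} ⇒ y ∈ (s)` (Kunz 1969 / Huneke–Swanson Thm. 13.1.2 (6):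
  every ideal of a regular local ring of prime characteristic is tightly, hence Frobenius, closed —
  `isFrobeniusClosed_of_isRegularLocalRing`, unfolded by `isFrobeniusClosed_iff`).

* `stub_fiClauseOfRegular` — the registered form, assembled from these three tree facts.

References: [Matsumura1987] H. Matsumura, *Commutative Ring Theory* (1987), Thm. 14.3 and Thm. 17.4;
E. Kunz, "Characterizations of regular local rings of characteristic `p`", Amer. J. Math. 91 (1969);
[HunekeSwanson2006] C. Huneke, I. Swanson, *Integral Closure of Ideals, Rings, and Modules* (2006),
Thm. 13.1.2 (6).
-/

-- single-problem summit: the doubled namespace component is forced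
set_option linter.dupNamespace false

namespace Summit.ResolutionOfSingularities.ResolutionOfSingularities.Theorems.FInjectiveMacaulayfication.FiClauseOfRegular

open Literature.RingTheory.TightClosure Literature.AlgebraicGeometry.Resolution

/-- **REGULAR ⇒ CLAUSE, ring level.** A regular local ring `O` of prime characteristic `p` is a domain
whose systems of parameters are weakly regular sequences and whose parameter ideals are Frobenius closed
(inline form): Matsumura Thm. 14.3 (`isDomain_of_isRegularLocalRing`), Matsumura Thm. 17.4
(`RegularStalksClimb_proof`) and Kunz (`isFrobeniusClosed_of_isRegularLocalRing`); the ring-level form of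
`Negative.rung_of_isRegular`. [cite: Matsumura1987, Thm. 14.3 and Thm. 17.4] -/
theorem stub_fiClauseOfRegular : ∀ (p : ℕ) [Fact p.Prime] (O : Type) [CommRing O] [IsRegularLocalRing O]
    [CharP O p], IsDomain O ∧
      ∀ d : ℕ, ringKrullDim O = d → ∀ s : Fin d → O, (Ideal.span (Set.range s)).radical.IsMaximal →
        RingTheory.Sequence.IsWeaklyRegular O (List.ofFn s) ∧
        ∀ y : O, (∃ e : ℕ, y ^ p ^ e ∈ Ideal.span ((fun z : O => z ^ p ^ e) ''
          (Ideal.span (Set.range s) : Set O))) → y ∈ Ideal.span (Set.range s) := by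
  intro p hp O _ _ _
  haveI : IsDomain O := isDomain_of_isRegularLocalRing O
  refine ⟨inferInstance, fun d hd s hs => ⟨?_, ?_⟩⟩
  · -- Matsumura Thm. 17.4: a system of parameters of a regular local ring is a regular sequence
    exact (Summit.ResolutionOfSingularities.ResolutionOfSingularities.Theorems.RegularStalksClimb_proof
      p hp.out O inferInstance d hd s hs).1
  · -- Kunz: every ideal of a regular local ring of characteristic `p` is Frobenius closed
    exact (isFrobeniusClosed_iff p).mp (isFrobeniusClosed_of_isRegularLocalRing p _)

end Summit.ResolutionOfSingularities.ResolutionOfSingularities.Theorems.FInjectiveMacaulayfication.FiClauseOfRegular
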